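import Mathlib
import Summits.ValiantsHypothesis.ValiantsHypothesis.Theorems.LacunarySymmetroidMatrixDescartesMonotoneExact
import Summits.ValiantsHypothesis.ValiantsHypothesis.Theorems.LacunarySymmetroidMatrixDescartesMonotoneIncoherencePencil

/-!
# `MatrixDescartes` (stmt-ValiantsHypothesis-18050) — STERILE FOR EVERY EXPONENT ASSIGNMENT ⟺ SIGN-COHERENT GRAM MATRIX;
# the exact monotone count for one signed column system split by sign

HONEST FRAMING.  Cell `pub-symmetroid`, seat `val-sym-mdr-p2` (gen 21); helper file `--supports` the crux
`Theses.LacunarySymmetroid.MatrixDescartes` (OPEN), NO closure claim; companion of `…MonotoneExact` (THE EXACT MONOTONE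
COUNT `Z₊ = ν(C₊₊) + π(C₋₋)` with multiplicity, two column blocks), `…GramDualCoherent` (the sign-coherent Gram law:
coherent ⇒ sterile at every exponent assignment) and `…MonotoneIncoherencePencil` (splitting a column system along a
predicate).  STRUCTURE theorems on signed column words; nothing here bears on the crux in its window, `stub_twoSided`,
`DoorA26` / `DoorA34`, registers, or `VP ≠ VNP`.

* `card_posRoots_multiset_eq_of_monotone_split` — the exact monotone count for ONE column system `U diag(σX^δ)Uᵀ` over
  `X^eB` (`det B ≠ 0`; `σⱼ > 0 ∧ δⱼ > e` or `σⱼ < 0 ∧ δⱼ < e`): the positive zeros counted with multiplicity number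
  `ν(UₚᵀB⁻¹Uₚ) + π(UₙᵀB⁻¹Uₙ)`, `Uₚ` / `Uₙ` the columns with `σ > 0` / `σ < 0` (reindex along `Equiv.sumCompl` and apply
  the two-block theorem); `card_posRoots_le_of_monotone_split` for distinct zeros.
* `form_subGram_pos` / `form_subGram_neg`, `one_le_negIndex_of_form_neg` / `one_le_posIndex_of_form_pos` — the Gram
  form of a sub-system is the full Gram form on vectors supported there; one vector with negative (positive) form forces
  `ν ≥ 1` (`π ≥ 1`).
* `coherent_of_posRoots_monotone_assignment_eq_empty` — if the system is sterile for the MONOTONE assignment `e = 1`,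
  `δⱼ = 2·[σⱼ > 0]`, then `UᵀB⁻¹U` is PSD on `P`-supported vectors and NSD on `N`-supported vectors.
* **`forall_posRoots_eq_empty_iff_coherent` (STERILE FOR EVERY EXPONENT ASSIGNMENT ⟺ COHERENT).**  `det B ≠ 0`,
  `σⱼ ≠ 0`: the word `X^eB + U diag(σX^δ)Uᵀ` has no positive zero for EVERY `(e, δ)` iff the Gram matrix `UᵀB⁻¹U` is
  PSD on the vectors supported on the positive columns and NSD on those supported on the negative columns — the
  CONVERSE of the sign-coherent Gram law; equivalently (`forall_posRoots_eq_empty_of_monotone_assignment`) sterility for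
  the single monotone assignment already forces sterility for all assignments.  Exponent-free sterility of a signed column
  configuration is thus decided by two semidefiniteness tests (no condition on the cross block).

[folklore] (Sylvester's law of inertia).  Axioms `propext`, `Classical.choice`, `Quot.sound`.  No definitions.
-/

-- layout Summits/ValiantsHypothesis/ValiantsHypothesis forces the duplicated namespace component
set_option linter.dupNamespace false

namespace Summit.ValiantsHypothesis.ValiantsHypothesis.Theorems.LacunarySymmetroidMatrixDescartes

open Polynomial Matrix Finset
open scoped BigOperators

namespace GramDual

section Split

variable {ι ρ : Type} [Fintype ι] [DecidableEq ι] [Fintype ρ] [DecidableEq ρ]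

/-- the signed column part (file-local notation, as in `…GramDualSigned`) -/
local notation3 (prettyPrint := false) "𝕊[" U ", " σ ", " δ "]" =>
  ((U : Matrix _ _ ℝ).map Polynomial.C
      * Matrix.diagonal (fun j => Polynomial.C ((σ : _ → ℝ) j) * (Polynomial.X : Polynomial ℝ) ^ (δ j : ℕ))
      * ((U : Matrix _ _ ℝ).map Polynomial.C)ᵀ)

/-- the positive sub-system of columns (file-local notation) -/
local notation3 (prettyPrint := false) "𝕌ₚ[" U ", " σ "]" =>
  (Matrix.of fun a (t : {j // 0 < (σ : _ → ℝ) j}) => (U : Matrix _ _ ℝ) a t.1)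

/-- the non-positive (= negative) sub-system of columns (file-local notation) -/
local notation3 (prettyPrint := false) "𝕌ₙ[" U ", " σ "]" =>
  (Matrix.of fun a (t : {j // ¬ 0 < (σ : _ → ℝ) j}) => (U : Matrix _ _ ℝ) a t.1)

/-! ## §1  The exact monotone count for one signed column system, split by sign -/

/-- **THE EXACT MONOTONE COUNT (one column system, split by sign).**  `B` real symmetric, `det B ≠ 0`; signed columns
with `σⱼ > 0 ∧ δⱼ > e` or `σⱼ < 0 ∧ δⱼ < e`.  Then the positive zeros of `det(X^eB + U diag(σX^δ) Uᵀ)` counted with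
multiplicity number exactly `ν(UₚᵀB⁻¹Uₚ) + π(UₙᵀB⁻¹Uₙ)`, `Uₚ` / `Uₙ` the positive / negative columns. [folklore] -/
theorem card_posRoots_multiset_eq_of_monotone_split (B : Matrix ι ι ℝ) (hBs : B.IsSymm) (hBu : IsUnit B.det)
    (U : Matrix ι ρ ℝ) (σ : ρ → ℝ) (e : ℕ) (δ : ρ → ℕ) (hmono : ∀ j, (0 < σ j ∧ e < δ j) ∨ (σ j < 0 ∧ δ j < e))
    (hCₚ : ((𝕌ₚ[U, σ])ᵀ * B⁻¹ * 𝕌ₚ[U, σ]).IsHermitian) (hCₙ : ((𝕌ₙ[U, σ])ᵀ * B⁻¹ * 𝕌ₙ[U, σ]).IsHermitian) :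
    Multiset.card ((Matrix.det (((Polynomial.X : Polynomial ℝ) ^ e) • B.map Polynomial.C + 𝕊[U, σ, δ])).roots.filter
        (fun t => 0 < t))
      = Fintype.card {j // hCₚ.eigenvalues j < 0} + Fintype.card {j // 0 < hCₙ.eigenvalues j} := by
  classical
  have hsplit : 𝕊[U, σ, δ]
      = 𝕊[𝕌ₚ[U, σ], (fun t : {j // 0 < σ j} => σ t.1), (fun t : {j // 0 < σ j} => δ t.1)]
        + 𝕊[𝕌ₙ[U, σ], (fun t : {j // ¬ 0 < σ j} => σ t.1), (fun t : {j // ¬ 0 < σ j} => δ t.1)] := by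
    rw [← signedPart_reindex U σ δ (Equiv.sumCompl fun j => 0 < σ j), submatrix_sumCompl_eq_fromCols,
      comp_sumCompl_eq_sum_elim, comp_sumCompl_eq_sum_elim, signedPart_fromCols]
  rw [hsplit, ← add_assoc]
  have hn : ∀ t : {j // ¬ 0 < σ j}, σ t.1 < 0 ∧ δ t.1 < e := fun t => by
    rcases hmono t.1 with ⟨h, -⟩ | h
    · exact absurd h t.2
    · exact h
  have hp : ∀ t : {j // 0 < σ j}, e < δ t.1 := fun t => by
    rcases hmono t.1 with ⟨-, h⟩ | ⟨h, -⟩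
    · exact h
    · exact absurd t.2 (not_lt.2 h.le)
  exact card_posRoots_multiset_eq_of_monotone B hBs hBu (𝕌ₚ[U, σ]) (𝕌ₙ[U, σ]) (fun t => σ t.1) (fun t => σ t.1)
    (fun t => t.2) (fun t => (hn t).1) e (fun t => δ t.1) (fun t => δ t.1) hp (fun t => (hn t).2) hCₚ hCₙ

/-- Distinct zeros: `Z₊ ≤ ν(UₚᵀB⁻¹Uₚ) + π(UₙᵀB⁻¹Uₙ)` on the monotone sector. [folklore] -/
theorem card_posRoots_le_of_monotone_split (B : Matrix ι ι ℝ) (hBs : B.IsSymm) (hBu : IsUnit B.det)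
    (U : Matrix ι ρ ℝ) (σ : ρ → ℝ) (e : ℕ) (δ : ρ → ℕ) (hmono : ∀ j, (0 < σ j ∧ e < δ j) ∨ (σ j < 0 ∧ δ j < e))
    (hCₚ : ((𝕌ₚ[U, σ])ᵀ * B⁻¹ * 𝕌ₚ[U, σ]).IsHermitian) (hCₙ : ((𝕌ₙ[U, σ])ᵀ * B⁻¹ * 𝕌ₙ[U, σ]).IsHermitian) :
    ((Matrix.det (((Polynomial.X : Polynomial ℝ) ^ e) • B.map Polynomial.C + 𝕊[U, σ, δ])).roots.toFinset.filter
        (fun t => 0 < t)).card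
      ≤ Fintype.card {j // hCₚ.eigenvalues j < 0} + Fintype.card {j // 0 < hCₙ.eigenvalues j} := by
  classical
  rw [← card_posRoots_multiset_eq_of_monotone_split B hBs hBu U σ e δ hmono hCₚ hCₙ, ← Multiset.toFinset_filter]
  exact Multiset.toFinset_card_le _

/-! ## §2  STERILE FOR EVERY EXPONENT ASSIGNMENT ⟺ SIGN-COHERENT GRAM MATRIX -/

omit [DecidableEq ρ] in
/-- The Gram form of the positive sub-system is the Gram form of the full system on `P`-supported vectors. [folklore] -/
theorem form_subGram_pos (B : Matrix ι ι ℝ) (U : Matrix ι ρ ℝ) (σ : ρ → ℝ) (v : {j // 0 < σ j} → ℝ) :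
    v ⬝ᵥ (((𝕌ₚ[U, σ])ᵀ * B⁻¹ * 𝕌ₚ[U, σ]) *ᵥ v)
      = (fun t => if h : 0 < σ t then v ⟨t, h⟩ else 0)
          ⬝ᵥ ((Uᵀ * B⁻¹ * U) *ᵥ fun t => if h : 0 < σ t then v ⟨t, h⟩ else 0) := by
  rw [← form_conj, subCols_mulVec_eq U (fun j => 0 < σ j) v, form_conj]

omit [DecidableEq ρ] in
/-- The Gram form of the negative sub-system is the Gram form of the full system on `N`-supported vectors. [folklore] -/
theorem form_subGram_neg (B : Matrix ι ι ℝ) (U : Matrix ι ρ ℝ) (σ : ρ → ℝ) (v : {j // ¬ 0 < σ j} → ℝ) :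
    v ⬝ᵥ (((𝕌ₙ[U, σ])ᵀ * B⁻¹ * 𝕌ₙ[U, σ]) *ᵥ v)
      = (fun t => if h : ¬ 0 < σ t then v ⟨t, h⟩ else 0)
          ⬝ᵥ ((Uᵀ * B⁻¹ * U) *ᵥ fun t => if h : ¬ 0 < σ t then v ⟨t, h⟩ else 0) := by
  rw [← form_conj, subCols_mulVec_eq U (fun j => ¬ 0 < σ j) v, form_conj]

/-- A one-member negative family: a vector with negative form forces `ν ≥ 1`. [folklore] -/
theorem one_le_negIndex_of_form_neg {κ : Type} [Fintype κ] [DecidableEq κ] {A : Matrix κ κ ℝ} (hA : A.IsHermitian)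
    (v : κ → ℝ) (hv : v ⬝ᵥ (A *ᵥ v) < 0) : 1 ≤ Fintype.card {j // hA.eigenvalues j < 0} := by
  have h := Inertia.card_le_negIndex hA (fun _ : Fin 1 => v) fun c hc => by
    have hc0 : c 0 ≠ 0 := fun h0 => hc (funext fun i => by fin_cases i; exact h0)
    rw [Fin.sum_univ_one, Matrix.mulVec_smul, smul_dotProduct, dotProduct_smul, smul_eq_mul, smul_eq_mul, ← mul_assoc]
    exact mul_neg_of_pos_of_neg (mul_self_pos.2 hc0) hv
  rwa [Fintype.card_fin] at h

/-- A one-member positive family: a vector with positive form forces `π ≥ 1`. [folklore] -/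
theorem one_le_posIndex_of_form_pos {κ : Type} [Fintype κ] [DecidableEq κ] {A : Matrix κ κ ℝ} (hA : A.IsHermitian)
    (v : κ → ℝ) (hv : 0 < v ⬝ᵥ (A *ᵥ v)) : 1 ≤ Fintype.card {j // 0 < hA.eigenvalues j} := by
  have h := Inertia.card_le_posIndex hA (fun _ : Fin 1 => v) fun c hc => by
    have hc0 : c 0 ≠ 0 := fun h0 => hc (funext fun i => by fin_cases i; exact h0)
    rw [Fin.sum_univ_one, Matrix.mulVec_smul, smul_dotProduct, dotProduct_smul, smul_eq_mul, smul_eq_mul, ← mul_assoc]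
    exact mul_pos (mul_self_pos.2 hc0) hv
  rwa [Fintype.card_fin] at h

/-- **The monotone assignment tests coherence.**  If the signed column system has no positive zero for the single
exponent assignment `e = 1`, `δⱼ = 2·[σⱼ > 0]` (positive columns above, negative columns below the base), then its Gram
matrix `UᵀB⁻¹U` is PSD on the vectors supported on the positive columns and NSD on those supported on the negative
columns. [folklore] -/
theorem coherent_of_posRoots_monotone_assignment_eq_empty (B : Matrix ι ι ℝ) (hBs : B.IsSymm) (hBu : IsUnit B.det)
    (U : Matrix ι ρ ℝ) (σ : ρ → ℝ) (hσ : ∀ j, σ j ≠ 0)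
    (h : (Matrix.det (((Polynomial.X : Polynomial ℝ) ^ 1) • B.map Polynomial.C
        + 𝕊[U, σ, (fun j => if 0 < σ j then 2 else 0)])).roots.toFinset.filter (fun t => 0 < t) = ∅) :
    (∀ v : ρ → ℝ, (∀ j, σ j < 0 → v j = 0) → 0 ≤ v ⬝ᵥ ((Uᵀ * B⁻¹ * U) *ᵥ v))
      ∧ (∀ v : ρ → ℝ, (∀ j, 0 < σ j → v j = 0) → v ⬝ᵥ ((Uᵀ * B⁻¹ * U) *ᵥ v) ≤ 0) := by
  classical
  have hCₚ : ((𝕌ₚ[U, σ])ᵀ * B⁻¹ * 𝕌ₚ[U, σ]).IsHermitian := isHermitian_gram hBs _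
  have hCₙ : ((𝕌ₙ[U, σ])ᵀ * B⁻¹ * 𝕌ₙ[U, σ]).IsHermitian := isHermitian_gram hBs _
  have hmono : ∀ j, (0 < σ j ∧ 1 < (fun j => if 0 < σ j then 2 else 0) j)
      ∨ (σ j < 0 ∧ (fun j => if 0 < σ j then 2 else 0) j < 1) := fun j => by
    rcases lt_or_gt_of_ne (hσ j) with hl | hg
    · refine Or.inr ⟨hl, ?_⟩
      simp only [if_neg (not_lt.2 hl.le)]; exact Nat.one_pos
    · refine Or.inl ⟨hg, ?_⟩
      simp only [if_pos hg]; exact Nat.lt_succ_self 1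
  have hcount := card_posRoots_multiset_eq_of_monotone_split B hBs hBu U σ 1 _ hmono hCₚ hCₙ
  have h0 : Multiset.card ((Matrix.det (((Polynomial.X : Polynomial ℝ) ^ 1) • B.map Polynomial.C
      + 𝕊[U, σ, (fun j => if 0 < σ j then 2 else 0)])).roots.filter (fun t => 0 < t)) = 0 := by
    rw [← Multiset.toFinset_filter, Multiset.toFinset_eq_empty] at h
    rw [h, Multiset.card_zero]
  rw [h0] at hcount
  constructor
  · intro v hv
    by_contra hneg
    push Not at hneg
    have hext : (fun t => if h : 0 < σ t then (fun s : {j // 0 < σ j} => v s.1) ⟨t, h⟩ else 0) = v := by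
      funext t
      split_ifs with ht
      · rfl
      · exact (hv t (lt_of_le_of_ne (not_lt.1 ht) (hσ t))).symm
    have hform : (fun s : {j // 0 < σ j} => v s.1) ⬝ᵥ (((𝕌ₚ[U, σ])ᵀ * B⁻¹ * 𝕌ₚ[U, σ]) *ᵥ fun s => v s.1) < 0 := by
      rw [form_subGram_pos, hext]; exact hneg
    have := one_le_negIndex_of_form_neg hCₚ _ hform
    omega
  · intro v hv
    by_contra hpos
    push Not at hpos
    have hext : (fun t => if h : ¬ 0 < σ t then (fun s : {j // ¬ 0 < σ j} => v s.1) ⟨t, h⟩ else 0) = v := by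
      funext t
      by_cases ht : 0 < σ t
      · rw [dif_neg (not_not.2 ht)]; exact (hv t ht).symm
      · rw [dif_pos ht]
    have hform : 0 < (fun s : {j // ¬ 0 < σ j} => v s.1)
        ⬝ᵥ (((𝕌ₙ[U, σ])ᵀ * B⁻¹ * 𝕌ₙ[U, σ]) *ᵥ fun s => v s.1) := by
      rw [form_subGram_neg, hext]; exact hpos
    have := one_le_posIndex_of_form_pos hCₙ _ hform
    omega

/-- **STERILE FOR EVERY EXPONENT ASSIGNMENT ⟺ SIGN-COHERENT GRAM MATRIX.**  `B` real symmetric, `det B ≠ 0`, columns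
`uⱼ` with signs `σⱼ ≠ 0`.  The signed column system `U diag(σ X^δ) Uᵀ` over the base `X^eB` has NO positive zero for
EVERY choice of the exponents `(e, δ)` if and only if the Gram matrix `UᵀB⁻¹U` is PSD on the vectors supported on the
positive columns and NSD on the vectors supported on the negative columns (no condition across).  `⇐` is the sign-coherent
Gram law (`posRoots_base_eq_empty_of_coherent`); `⇒` tests the MONOTONE assignment with the exact count. [folklore] -/
theorem forall_posRoots_eq_empty_iff_coherent (B : Matrix ι ι ℝ) (hBs : B.IsSymm) (hBu : IsUnit B.det)
    (U : Matrix ι ρ ℝ) (σ : ρ → ℝ) (hσ : ∀ j, σ j ≠ 0) :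
    (∀ (e : ℕ) (δ : ρ → ℕ),
        (Matrix.det (((Polynomial.X : Polynomial ℝ) ^ e) • B.map Polynomial.C + 𝕊[U, σ, δ])).roots.toFinset.filter
          (fun t => 0 < t) = ∅)
      ↔ (∀ v : ρ → ℝ, (∀ j, σ j < 0 → v j = 0) → 0 ≤ v ⬝ᵥ ((Uᵀ * B⁻¹ * U) *ᵥ v))
        ∧ (∀ v : ρ → ℝ, (∀ j, 0 < σ j → v j = 0) → v ⬝ᵥ ((Uᵀ * B⁻¹ * U) *ᵥ v) ≤ 0) :=
  ⟨fun h => coherent_of_posRoots_monotone_assignment_eq_empty B hBs hBu U σ hσ (h 1 _),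
    fun h e δ => posRoots_base_eq_empty_of_coherent B hBs hBu U σ hσ e δ h.1 h.2⟩

/-- **Sterile for the monotone assignment ⇒ sterile for every assignment.** [folklore] -/
theorem forall_posRoots_eq_empty_of_monotone_assignment (B : Matrix ι ι ℝ) (hBs : B.IsSymm) (hBu : IsUnit B.det)
    (U : Matrix ι ρ ℝ) (σ : ρ → ℝ) (hσ : ∀ j, σ j ≠ 0)
    (h : (Matrix.det (((Polynomial.X : Polynomial ℝ) ^ 1) • B.map Polynomial.C
        + 𝕊[U, σ, (fun j => if 0 < σ j then 2 else 0)])).roots.toFinset.filter (fun t => 0 < t) = ∅)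
    (e : ℕ) (δ : ρ → ℕ) :
    (Matrix.det (((Polynomial.X : Polynomial ℝ) ^ e) • B.map Polynomial.C + 𝕊[U, σ, δ])).roots.toFinset.filter
        (fun t => 0 < t) = ∅ :=
  (forall_posRoots_eq_empty_iff_coherent B hBs hBu U σ hσ).2
    (coherent_of_posRoots_monotone_assignment_eq_empty B hBs hBu U σ hσ h) e δ

end Split

end GramDual

end Summit.ValiantsHypothesis.ValiantsHypothesis.Theorems.LacunarySymmetroidMatrixDescartes
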